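import Summits.BirchSwinnertonDyer.BirchSwinnertonDyer.Theorems.PrintX9MuPartStabilizedCoherentPairOfCyclic
import Literature.NumberTheory.EllipticCurves.ZpExtensionEisensteinDVRSetting
import Literature.NumberTheory.EllipticCurves.LambdaAdicSelmerDataToEisensteinH1Linear
import Literature.NumberTheory.GaloisCohomology.Howard2004.DVRKolyvaginBound
import HarnessLib

/-!
# Skeleton v3 of line `spec_witnesses` on the SHARED μ-crux `MuInequalityCoherentPair`
# (stmt-BirchSwinnertonDyer-22642; THE CUT v2; item text = L∃ `HeegnerMuPartStabilized.MuPartStabilizedCoherentPair`) — μ LEAD x9-p1 (g3)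

v2 (registered 16:52Z) has ONE stub `stub_portCyclic`.  v3 splits it along road R1′ into two stubs joined by the
cite-only binder h161 = `Howard2004.thm161_dvrKolyvaginBound` (REF-131/132):
* `stub_howardInputs` — for `m ≫ 0` the Eisenstein DVR setting of the curve (D1, p648337) built on `κ⁻ = κ.unitTwist (-1)`
  admits data (S, L, jbar′, cd, duality, fs, pinned `H¹(K,T_𝔮)` `I`) with `SatisfiesH`, `LargePrimes` and a Kolyvagin system
  whose bottom class is the image of the stabilised class `z` under the compact control map, nonzero;
* `stub_controlGlue` — for `m ≫ 0`, uniformly in `m`, Howard's `Conclusion` at that bottom class yields a `SpecWitness`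
  (m-uniform control of the Selmer and dual sides + the glue `nonempty_specWitness_of_dvrConclusion`, p643969).
Composition `portCyclic_of` ⟹ `MuInequalityCoherentPair_of` (p644084: engine-with-class + p633080); no `sorry`
outside the stubs; the cite-only fact h161 enters as the registered pseudo-stub `stub_h161` (the skeleton checker admits
no free hypothesis) — road R1′, μ-LEAD ruling 13:25Z/14:56Z; PLANNER: make it a route binder of the shared item.
CONVENTIONS FIXED HERE (D1 to confirm; a mismatch is a cheap reshape of `ctrlLevel` only): the setting is
`W.eisensteinDVRSetting (κ.unitTwist (-1)) hm …` (the sign of `toEisensteinH1Linear`), level `k` of the setting is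
level `k+1` of the pinned `H¹(K, T_𝔮)` (`ctrlLevel … k = I.proj (k+1) (toEisensteinH1Linear … z)`).
OWNERS: `stub_howardInputs` — D1 lineage (the `SatisfiesH` fields: x10b-p1 LEAD g7 bookkeeping, w5 (f) H.4-at-p,
w6/x10b-p2 (e) H.3, w7 (e′), w3 (g) cond_red, w4 h4 transport, w2 g5 H.1/H.5a/LargePrimes inputs) + x9-p2 g3 / lit
((F-411) on the Shapiro-diagonal source, the `Hom` into the setting, `KolyvaginSystem.ofHom` p649237, `κ.one ≠ 0` by
p646660); `stub_controlGlue` — D1 control seats (w2 g6/g7 (S)/(ur)/(p) clauses, Prop. 2.2.8 uniformity) + the glue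
`nonempty_specWitness_of_dvrConclusion` (p643969) / w2 g5's additive twin p643360.
ROUTE-INDEPENDENT (no `Theses` import).  BEYOND CITABLE PRINT at `p ∣ h_K` (REF-118).  BSD is NOT proved by this file.
-/

set_option linter.dupNamespace false
set_option autoImplicit false

noncomputable section

open scoped Classical Pointwise ContRepresentation TensorProduct

open Literature Literature.NumberTheory.EllipticCurves WeierstrassCurve
open Literature.NumberTheory.GaloisCohomology.Howard2004
open Literature.NumberTheory.GaloisRepresentations Literature.NumberTheory.GaloisRepresentations.DiscreteGaloisModule
open Summit.BirchSwinnertonDyer.BirchSwinnertonDyer.Theorems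

namespace Summit.BirchSwinnertonDyer.BirchSwinnertonDyer.Cruxes.MuInequalityCoherentPair.SpecWitnesses

/-- **The LINK**: the level-`k` component of the compact control map `𝔖 → H¹(K, T_𝔮)` at `z` (D1's
`toEisensteinH1Linear`, projected to level `k+1` of the pinned `H¹(K, T_𝔮)` `I`) — the bottom class the Kolyvagin
system must have. -/
def ctrlLevel {K : Type} [Field K] [NumberField K] {p : ℕ} [Fact p.Prime] (V : WeierstrassCurve K) [V.IsElliptic]
    (κ : ZpExtension K p) (γ : Field.absoluteGaloisGroup K) {m : ℕ} (hm : 1 ≤ m)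
    (t : ∀ k, (V.torsionGaloisModule ((p : ℤ) ^ (k + 1))).toContRepresentation →ⁱL
      (V.torsionGaloisModule ((p : ℤ) ^ k)).toContRepresentation)
    (ht : ∀ k (P : geomTorsion V ((p : ℤ) ^ (k + 1))), t k P = V.geomTorsionReduce p k P)
    (I : ZpExtension.EisensteinH1Data (κ.unitTwist (-1)) (fun k ↦ V.torsionGaloisModule ((p : ℤ) ^ k)) t hm)
    (D : V.LambdaAdicSelmerData κ γ) (hγ : κ.IsTopGenerator γ)
    (hE : ∀ P : V.toAffine.Point, p • P = 0 → P = 0) (z : D.S) (k : ℕ) :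
    galoisCohomology ((κ.unitTwist (-1)).eisensteinTwist (V.torsionGaloisModule ((p : ℤ) ^ (k + 1))) hm (k + 1)) 1 :=
  I.proj (k + 1) (D.toEisensteinH1Linear hm t ht I hγ hE z)

set_option synthInstance.maxHeartbeats 80000 in
/-- **Letter of `stub_howardInputs`.** -/
abbrev Stmt.howardInputs : Prop :=
  ∀ (N : ℕ) [NeZero N] (W : WeierstrassCurve ℚ) [W.IsGloballyMinimal] (K : Type) [Field K] [NumberField K]
    (p : ℕ) [Fact p.Prime] (κ : ZpExtension K p) (γ : Field.absoluteGaloisGroup K)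
    (jbar : AlgebraicClosure K →+* ℂ) (hyp : CastellaGrossiLeeSkinner2022.Thm413Hypotheses N W K p κ γ),
    ¬ W.HasCM → W.HasIrreducibleModPGaloisRep p → (W.baseChange K).HasIrreducibleModPGaloisRep p →
    MastellaZerman2026.HasPadicScalarImage W p → SatisfiesHeegnerHypothesis p K →
    p ∣ NumberField.classNumber K →
    ∀ (D : (W.baseChange K).LambdaAdicSelmerData κ γ)
      (C : CastellaGrossiLeeSkinner2022.StabilizedHeegnerData N W K κ jbar)
      (X : (W.baseChange K).SelmerDualData κ γ) (z : D.S),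
    (∀ (k : ℕ) (hk : C.depth < k), D.proj k z ∈ CastellaGrossiLeeSkinner2022.stabilizedClassLayer C k hk) →
    CastellaGrossiLeeSkinner2022.stabilizedHeegnerModule D C = Submodule.span (IwasawaAlgebra p) {z} →
    Module.Finite (IwasawaAlgebra p) D.S → Module.Finite (IwasawaAlgebra p) X.X →
    Module.IsTorsion (IwasawaAlgebra p) (D.S ⧸ CastellaGrossiLeeSkinner2022.stabilizedHeegnerModule D C) →
    ∃ m₀ : ℕ, ∀ (m : ℕ) (hm : 1 ≤ m), m₀ ≤ m →
      haveI := hyp.isElliptic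
      letI := IwasawaAlgebra.isDomain_quotient_X_pow_add_C p hm
      letI := IwasawaAlgebra.isDiscreteValuationRing_quotient_X_pow_add_C p hm
      haveI := IwasawaAlgebra.EisensteinCoeff.isLocalRing_succ p hm
      letI := IwasawaAlgebra.EisensteinCoeff.algebraOfSpecSucc p m
      haveI := W.isScalarTower_algebraOfSpecSucc (K := K) (p := p) (m := m)
      letI := W.residueModuleSucc (K := K) (p := p) hm
      ∃ (S : Finset (IsDedekindDomain.HeightOneSpectrum (NumberField.RingOfIntegers K)))
        (hpS : ∀ v, ((p : ℕ) : NumberField.RingOfIntegers K) ∈ v.asIdeal → v ∈ S)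
        (hbad : ∀ v, v ∉ S → ((p : ℕ) : NumberField.RingOfIntegers K) ∉ v.asIdeal →
          (W.baseChange K).HasGoodReductionAt v)
        (L : Set (IsDedekindDomain.HeightOneSpectrum (NumberField.RingOfIntegers K)))
        (hL : L ⊆ (W.eisensteinTower (κ.unitTwist (-1)) hm).degreeTwoPrimes p)
        (hLS : ∀ v ∈ L, v ∉ S) (jbar' : AlgebraicClosure K →+* ℂ) (cd : ConjugationDatum K)
        (Dd : ∀ k, DualityDatum p cd ((W.eisensteinTower (κ.unitTwist (-1)) hm).ρ k)
          (IwasawaAlgebra.EisensteinCoeff p m (k + 1)))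
        (fs : ∀ (k : ℕ) (n : Finset (IsDedekindDomain.HeightOneSpectrum (NumberField.RingOfIntegers K)))
          (v : IsDedekindDomain.HeightOneSpectrum (NumberField.RingOfIntegers K)),
          galoisCohomology ((W.eisensteinLevelQuot (κ.unitTwist (-1)) hm k n).toLocal (Sum.inr v)) 1 →+
            SingularQuotient (GaloisRep.toLocal v (W.eisensteinLevelQuot (κ.unitTwist (-1)) hm k n)) ⊗[ℤ]
              Gell v)
        (t : ∀ k, ((W.baseChange K).torsionGaloisModule ((p : ℤ) ^ (k + 1))).toContRepresentation →ⁱL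
          ((W.baseChange K).torsionGaloisModule ((p : ℤ) ^ k)).toContRepresentation)
        (ht : ∀ k (P : geomTorsion (W.baseChange K) ((p : ℤ) ^ (k + 1))),
          t k P = (W.baseChange K).geomTorsionReduce p k P)
        (I : ZpExtension.EisensteinH1Data (κ.unitTwist (-1))
          (fun k ↦ (W.baseChange K).torsionGaloisModule ((p : ℤ) ^ k)) t hm)
        (_hy : (W.eisensteinDVRSetting (κ.unitTwist (-1)) hm S hpS hbad L hL hLS jbar' cd Dd fs).SatisfiesH)
        (κKS : (W.eisensteinDVRSetting (κ.unitTwist (-1)) hm S hpS hbad L hL hLS jbar' cd Dd fs).KolyvaginSystem),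
        (W.eisensteinDVRSetting (κ.unitTwist (-1)) hm S hpS hbad L hL hLS jbar' cd Dd fs).LargePrimes ∧
        κKS.one ≠ 0 ∧
        ∀ k, κKS.one k = ctrlLevel (W.baseChange K) κ γ hm t ht I D hyp.topGenerator hyp.noPTorsion z k

set_option synthInstance.maxHeartbeats 80000 in
/-- **Letter of `stub_controlGlue`.** -/
abbrev Stmt.controlGlue : Prop :=
  ∀ (N : ℕ) [NeZero N] (W : WeierstrassCurve ℚ) [W.IsGloballyMinimal] (K : Type) [Field K] [NumberField K]
    (p : ℕ) [Fact p.Prime] (κ : ZpExtension K p) (γ : Field.absoluteGaloisGroup K)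
    (jbar : AlgebraicClosure K →+* ℂ) (hyp : CastellaGrossiLeeSkinner2022.Thm413Hypotheses N W K p κ γ),
    ¬ W.HasCM → W.HasIrreducibleModPGaloisRep p → (W.baseChange K).HasIrreducibleModPGaloisRep p →
    MastellaZerman2026.HasPadicScalarImage W p → SatisfiesHeegnerHypothesis p K →
    p ∣ NumberField.classNumber K →
    ∀ (D : (W.baseChange K).LambdaAdicSelmerData κ γ)
      (C : CastellaGrossiLeeSkinner2022.StabilizedHeegnerData N W K κ jbar)
      (X : (W.baseChange K).SelmerDualData κ γ) (z : D.S),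
    (∀ (k : ℕ) (hk : C.depth < k), D.proj k z ∈ CastellaGrossiLeeSkinner2022.stabilizedClassLayer C k hk) →
    CastellaGrossiLeeSkinner2022.stabilizedHeegnerModule D C = Submodule.span (IwasawaAlgebra p) {z} →
    Module.Finite (IwasawaAlgebra p) D.S → Module.Finite (IwasawaAlgebra p) X.X →
    Module.IsTorsion (IwasawaAlgebra p) (D.S ⧸ CastellaGrossiLeeSkinner2022.stabilizedHeegnerModule D C) →
    ∃ c m₁ : ℕ, ∀ (m : ℕ) (hm : 1 ≤ m), m₁ ≤ m →
      haveI := hyp.isElliptic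
      letI := IwasawaAlgebra.isDomain_quotient_X_pow_add_C p hm
      letI := IwasawaAlgebra.isDiscreteValuationRing_quotient_X_pow_add_C p hm
      haveI := IwasawaAlgebra.EisensteinCoeff.isLocalRing_succ p hm
      letI := IwasawaAlgebra.EisensteinCoeff.algebraOfSpecSucc p m
      haveI := W.isScalarTower_algebraOfSpecSucc (K := K) (p := p) (m := m)
      letI := W.residueModuleSucc (K := K) (p := p) hm
      ∀ (S : Finset (IsDedekindDomain.HeightOneSpectrum (NumberField.RingOfIntegers K)))
        (hpS : ∀ v, ((p : ℕ) : NumberField.RingOfIntegers K) ∈ v.asIdeal → v ∈ S)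
        (hbad : ∀ v, v ∉ S → ((p : ℕ) : NumberField.RingOfIntegers K) ∉ v.asIdeal →
          (W.baseChange K).HasGoodReductionAt v)
        (L : Set (IsDedekindDomain.HeightOneSpectrum (NumberField.RingOfIntegers K)))
        (hL : L ⊆ (W.eisensteinTower (κ.unitTwist (-1)) hm).degreeTwoPrimes p)
        (hLS : ∀ v ∈ L, v ∉ S) (jbar' : AlgebraicClosure K →+* ℂ) (cd : ConjugationDatum K)
        (Dd : ∀ k, DualityDatum p cd ((W.eisensteinTower (κ.unitTwist (-1)) hm).ρ k)
          (IwasawaAlgebra.EisensteinCoeff p m (k + 1)))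
        (fs : ∀ (k : ℕ) (n : Finset (IsDedekindDomain.HeightOneSpectrum (NumberField.RingOfIntegers K)))
          (v : IsDedekindDomain.HeightOneSpectrum (NumberField.RingOfIntegers K)),
          galoisCohomology ((W.eisensteinLevelQuot (κ.unitTwist (-1)) hm k n).toLocal (Sum.inr v)) 1 →+
            SingularQuotient (GaloisRep.toLocal v (W.eisensteinLevelQuot (κ.unitTwist (-1)) hm k n)) ⊗[ℤ]
              Gell v)
        (t : ∀ k, ((W.baseChange K).torsionGaloisModule ((p : ℤ) ^ (k + 1))).toContRepresentation →ⁱL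
          ((W.baseChange K).torsionGaloisModule ((p : ℤ) ^ k)).toContRepresentation)
        (ht : ∀ k (P : geomTorsion (W.baseChange K) ((p : ℤ) ^ (k + 1))),
          t k P = (W.baseChange K).geomTorsionReduce p k P)
        (I : ZpExtension.EisensteinH1Data (κ.unitTwist (-1))
          (fun k ↦ (W.baseChange K).torsionGaloisModule ((p : ℤ) ^ k)) t hm)
        (hy : (W.eisensteinDVRSetting (κ.unitTwist (-1)) hm S hpS hbad L hL hLS jbar' cd Dd fs).SatisfiesH),
        (W.eisensteinDVRSetting (κ.unitTwist (-1)) hm S hpS hbad L hL hLS jbar' cd Dd fs).Conclusion hy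
            (fun k ↦ ctrlLevel (W.baseChange K) κ γ hm t ht I D hyp.topGenerator hyp.noPTorsion z k) →
          Nonempty (HeegnerMuPartStabilized.SpecWitness (IwasawaAlgebra p) D.S X.X
            (CastellaGrossiLeeSkinner2022.stabilizedHeegnerModule D C)
            (PowerSeries.X ^ m + PowerSeries.C (p : ℤ_[p]) : IwasawaAlgebra p) (p ^ c))

/-- v2 letter (record; now DERIVED): the cyclic port statement. -/
abbrev Stmt.portCyclic : Prop :=
  ∀ (N : ℕ) [NeZero N] (W : WeierstrassCurve ℚ) [W.IsGloballyMinimal] (K : Type) [Field K] [NumberField K]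
    (p : ℕ) [Fact p.Prime] (κ : ZpExtension K p) (γ : Field.absoluteGaloisGroup K)
    (jbar : AlgebraicClosure K →+* ℂ),
    CastellaGrossiLeeSkinner2022.Thm413Hypotheses N W K p κ γ →
    ¬ W.HasCM → W.HasIrreducibleModPGaloisRep p → (W.baseChange K).HasIrreducibleModPGaloisRep p →
    MastellaZerman2026.HasPadicScalarImage W p → SatisfiesHeegnerHypothesis p K →
    p ∣ NumberField.classNumber K →
    ∀ (D : (W.baseChange K).LambdaAdicSelmerData κ γ)
      (C : CastellaGrossiLeeSkinner2022.StabilizedHeegnerData N W K κ jbar)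
      (X : (W.baseChange K).SelmerDualData κ γ) (z : D.S),
    (∀ (k : ℕ) (hk : C.depth < k), D.proj k z ∈ CastellaGrossiLeeSkinner2022.stabilizedClassLayer C k hk) →
    CastellaGrossiLeeSkinner2022.stabilizedHeegnerModule D C = Submodule.span (IwasawaAlgebra p) {z} →
    Module.Finite (IwasawaAlgebra p) D.S → Module.Finite (IwasawaAlgebra p) X.X →
    Module.IsTorsion (IwasawaAlgebra p) (D.S ⧸ CastellaGrossiLeeSkinner2022.stabilizedHeegnerModule D C) →
    HeegnerMuPartStabilized.HasSpecWitnesses p D.S X.X (CastellaGrossiLeeSkinner2022.stabilizedHeegnerModule D C)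

/-! ## Stubs -/

/-- `stub_howardInputs` — OPEN (H.0–H.5 + LargePrimes + the Kolyvagin system on the Eisenstein DVR setting, its
bottom class the image of the stabilised class, nonzero, for `m ≫ 0`). -/
theorem stub_howardInputs : Stmt.howardInputs := by
  sorry

/-- `stub_controlGlue` — OPEN (m-uniform control + glue: Howard's conclusion at the image class ⟹ a `SpecWitness`). -/
theorem stub_controlGlue : Stmt.controlGlue := by
  sorry

/-- `stub_h161` — the CITE-ONLY print fact Howard 2004 Thm. 1.6.1 (`Howard2004.thm161_dvrKolyvaginBound`, (W9)-B
p642393/p646217, REF-131/132 compliant, fs slot pinned).  NOT a worker obligation: road R1′ CITES it.  Registered as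
a stub only so that the composition's dependence on it is an explicit obligation of the crux; PLANNER: convert it
into a ROUTE BINDER of the shared item (like the cite-only binders of 27077/27275), after which this stub is
discharged by the binder and disappears from the skeleton. -/
theorem stub_h161 : Literature.NumberTheory.GaloisCohomology.Howard2004.thm161_dvrKolyvaginBound := by
  sorry

/-! ## Composition -/

set_option synthInstance.maxHeartbeats 80000 in
/-- **The cyclic port statement from the two stubs and Howard's Thm. 1.6.1 (cited, `stub_h161`).** -/
theorem portCyclic_of : Stmt.portCyclic := by
  have h161 := stub_h161
  intro N _ W _ K _ _ p _ κ γ jbar hyp hCM hirr hirrK hsc hHp hhK D C X z hz hcyc hfinS hfinX htor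
  obtain ⟨m₀, hA⟩ := stub_howardInputs N W K p κ γ jbar hyp hCM hirr hirrK hsc hHp hhK D C X z hz hcyc hfinS hfinX htor
  obtain ⟨c, m₁, hB⟩ := stub_controlGlue N W K p κ γ jbar hyp hCM hirr hirrK hsc hHp hhK D C X z hz hcyc hfinS hfinX htor
  refine ⟨c, max (max m₀ m₁) 1, fun m hm' ↦ ?_⟩
  have hm : 1 ≤ m := le_trans (le_max_right _ _) hm'
  have hm0 : m₀ ≤ m := le_trans ((le_max_left _ _).trans (le_max_left _ _)) hm'
  have hm1 : m₁ ≤ m := le_trans ((le_max_right _ _).trans (le_max_left _ _)) hm'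
  haveI := hyp.isElliptic
  letI := IwasawaAlgebra.isDomain_quotient_X_pow_add_C p hm
  letI := IwasawaAlgebra.isDiscreteValuationRing_quotient_X_pow_add_C p hm
  haveI := IwasawaAlgebra.EisensteinCoeff.isLocalRing_succ p hm
  letI := IwasawaAlgebra.EisensteinCoeff.algebraOfSpecSucc p m
  haveI := W.isScalarTower_algebraOfSpecSucc (K := K) (p := p) (m := m)
  letI := W.residueModuleSucc (K := K) (p := p) hm
  obtain ⟨S, hpS, hbad, L, hL, hLS, jbar', cd, Dd, fs, t, ht, I, hy, κKS, hlarge, hone, hlink⟩ := hA m hm hm0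
  have hconc := h161 p K _ _ _ _ _ (W.eisensteinDVRSetting (κ.unitTwist (-1)) hm S hpS hbad L hL hLS jbar' cd Dd fs)
    κKS hy hlarge hone
  have hone_eq : κKS.one =
      fun k ↦ ctrlLevel (W.baseChange K) κ γ hm t ht I D hyp.topGenerator hyp.noPTorsion z k :=
    funext hlink
  rw [hone_eq] at hconc
  exact hB m hm hm1 S hpS hbad L hL hLS jbar' cd Dd fs t ht I hy hconc

/-- The shared μ-crux letter L∃ from the stubs (p644084). -/
theorem MuInequalityCoherentPair_of : HeegnerMuPartStabilized.MuPartStabilizedCoherentPair :=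
  HeegnerMuPartStabilized.muPartStabilizedCoherentPair_of_forall_cyclic portCyclic_of

end Summit.BirchSwinnertonDyer.BirchSwinnertonDyer.Cruxes.MuInequalityCoherentPair.SpecWitnesses

end
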